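import Mathlib.Analysis.SpecificLimits.Basic
import Mathlib.Algebra.BigOperators.Field
import HarnessLib

/-!
# The hard-core pair of two downward-FKG laws — abstract finite core, part I: the averaging step,
# the monotonicity flip and the Doeblin contraction

Support file (prover prim-facecert gen 14; `--supports stmt-CriticalPhenomena-4575`); builds on the lead seat
prim-nh-lead-4575's gen-105 programme (memo `run/shared/lean/prim/prim-nh-lead-4575/LEAD-GEN105.md` §1(6): conjecture (HC)
"hard-core Harris", its reduction to PA-BERN = `Consts.FibrewiseBHK`, and the pencil proof of the MEASURE-LEVEL two-copy
statement by an averaging-operator iteration; `|N| = 1` in the kernel: `…ConstsHardCoreHarrisOne`).  No definitions, no named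
facts, no sorries; standard axioms.

SETTING (this file and its sequels `…ConstsTwoCopyDownwardFKG`, `…ConstsTwoCopyDownwardFKGCorollaries`).  Two finite
(pre)ordered types `α, β` ("the clusters of copy 0 / copy 1") with nonnegative weights `p, p'`, and a `0/1` COMPATIBILITY KERNEL
`κ : α → β → ℝ`, antitone in each argument (the two-copy hard-core constraint `V(C₀) ∩ V(C₁) ∩ N = ∅`).  The pair weight is
`p a · p' b · κ a b` (two INDEPENDENT copies conditioned on compatibility).  Notation used in the statements, always passed as
variables with their defining equations (no definitions are introduced): `m₀ b = Σ_a p a κ a b` (mass of copy-0 states compatible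
with `b`), `ν₀ a = Σ_b p a p' b κ a b`, `ν₁ b = Σ_a p a p' b κ a b` (the two marginals of the pair weight), and the AVERAGING
OPERATOR `(TX) b = (Σ_a p a κ a b X a) / m₀ b` (conditional mean of a copy-0 observable given the partner `b`), written
`TX b · m₀ b = Σ_a p a κ a b X a`.

HYPOTHESIS "conditionally positively associated given each partner" (`hPA`): for every `b`, under the weights `a ↦ p a κ a b`
monotone functions are positively correlated.  When `κ a b = 1{Z(a) ∩ Z'(b) = ∅}` for set-valued monotone "footprints" this is
exactly the DOWNWARD FKG property of the footprint law (Liggett–Steif; van den Berg–Häggström–Kahn: "the conditional measure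
`μ(· | η ≡ 0 on A)` is associated for every `A`"), which for the percolation cluster `C_S` IS van den Berg–Häggström–Kahn's
Theorem 1.3 (conditioning on `{S ↮ A}`).

CONTENT (all elementary finite sums):
* `markov_contract` — Doeblin: two probability vectors dominating a common sub-probability vector of mass `δ` average any `h`
  to within `(1 − δ)·osc h`;  `cov_ge_neg` — `Q·Σνhk − Σνh·Σνk ≥ −½Q²·osc h·osc k`;
* `pair_sum_transfer`, `transfer` — `Σ_a ν₀ a X a = Σ_b ν₁ b (TX) b`;
* `step` — THE AVERAGING STEP: `Q·Σν₁(TF)(TG) − (Σν₁TF)(Σν₁TG) ≤ Q·Σν₀FG − (Σν₀F)(Σν₀G)` (the difference is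
  `Q·Σ_b ν₁ b·[T(FG) − TF·TG](b) ≥ 0` by `hPA`) — the measure-level argument of LEAD-GEN105 §1(6), made abstract;
* `transfer_antitone` / `transfer_monotone` — `T` maps monotone to antitone functions and vice versa (`hPA` applied to `F` and the
  antitone indicator `κ(·, b')`; this is where `κ ∈ {0,1}` and "antitone in each argument" are used);
* `transfer_contract` — `T` contracts oscillations by `1 − p(B₀)/p(α)` when the "bottom" `B₀` is compatible with every partner.
Part II iterates `T` in both directions and lets the number of iterations tend to infinity.

References: T. M. Liggett, *Conditional association and spin systems*, ALEA 1 (2006) 1–19, §1 (downward FKG, DCA, display (1.7))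
[Liggett2006ConditionalAssociation]; T. M. Liggett, J. E. Steif, *Stochastic domination: the contact process, Ising models and FKG
measures*, AIHP 42 (2006) [LiggettSteif2006]; J. van den Berg, O. Häggström, J. Kahn, RSA 29 (2006), Thm. 1.3 and proof of Thm. 1.5
[VandenbergHaggstromKahn2005].
-/

namespace Summit.CriticalPhenomena.PercolationContinuityZ3.Theorems

namespace TwoCopyHardCore

open Finset

variable {α β : Type*} [Fintype α] [Fintype β]

/-- **Doeblin contraction for one averaging step.**  If two probability vectors `u, v` on a finite type both
dominate the same sub-probability vector `c` of mass `δ`, then for every `h` of oscillation at most `D`,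
`Σ u h − Σ v h ≤ (1 − δ)·D`. [folklore] -/
theorem markov_contract (u v c h : α → ℝ) (D : ℝ)
    (hu : ∀ a, c a ≤ u a) (hv : ∀ a, c a ≤ v a)
    (hu1 : ∑ a, u a = 1) (hv1 : ∑ a, v a = 1) (hD : ∀ a a', h a - h a' ≤ D) :
    ∑ a, u a * h a - ∑ a, v a * h a ≤ (1 - ∑ a, c a) * D := by
  -- `u' = u - c`, `v' = v - c` are nonnegative of equal mass `s = 1 - δ`
  set s : ℝ := 1 - ∑ a, c a with hs
  have hD0 : 0 ≤ D := by
    rcases isEmpty_or_nonempty α with hα | ⟨⟨a⟩⟩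
    · have h1 : (∑ a, u a) = 0 := by simp
      linarith
    · have := hD a a; linarith
  have hsu : ∑ a, (u a - c a) = s := by rw [Finset.sum_sub_distrib, hu1]
  have hsv : ∑ a, (v a - c a) = s := by rw [Finset.sum_sub_distrib, hv1]
  have hs0 : 0 ≤ s := by rw [← hsu]; exact Finset.sum_nonneg fun a _ => sub_nonneg.2 (hu a)
  -- the difference only sees `u', v'`
  have hdiff : ∑ a, u a * h a - ∑ a, v a * h a =
      ∑ a, (u a - c a) * h a - ∑ a, (v a - c a) * h a := by
    rw [← Finset.sum_sub_distrib, ← Finset.sum_sub_distrib]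
    exact Finset.sum_congr rfl fun a _ => by ring
  -- key identity: `s · (Σ u' h − Σ v' h) = Σ_a Σ_a' u'_a v'_a' (h a − h a')`
  have hkey : s * (∑ a, (u a - c a) * h a - ∑ a, (v a - c a) * h a) =
      ∑ a, ∑ a', (u a - c a) * (v a' - c a') * (h a - h a') := by
    have e1 : ∑ a, ∑ a', (u a - c a) * (v a' - c a') * (h a - h a') =
        ∑ a, ∑ a', ((u a - c a) * h a * (v a' - c a') - (u a - c a) * ((v a' - c a') * h a')) :=
      Finset.sum_congr rfl fun a _ => Finset.sum_congr rfl fun a' _ => by ring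
    rw [e1]
    simp only [Finset.sum_sub_distrib, ← Finset.mul_sum, ← Finset.sum_mul]
    rw [hv1, hu1, ← hs]
    ring
  have hbound : ∑ a, ∑ a', (u a - c a) * (v a' - c a') * (h a - h a') ≤
      ∑ a, ∑ a', (u a - c a) * (v a' - c a') * D :=
    Finset.sum_le_sum fun a _ => Finset.sum_le_sum fun a' _ =>
      mul_le_mul_of_nonneg_left (hD a a') (mul_nonneg (sub_nonneg.2 (hu a)) (sub_nonneg.2 (hv a')))
  have hDsum : ∑ a, ∑ a', (u a - c a) * (v a' - c a') * D = s * s * D := by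
    simp only [← Finset.sum_mul, ← Finset.mul_sum]
    rw [hsv, hsu]
  rw [hdiff]
  rcases hs0.eq_or_lt with hs00 | hspos
  · -- `s = 0`: `u' = v' = 0`
    have hu' : ∀ a, u a - c a = 0 := by
      intro a
      have hle : ∀ a ∈ (Finset.univ : Finset α), 0 ≤ u a - c a := fun a _ => sub_nonneg.2 (hu a)
      exact (Finset.sum_eq_zero_iff_of_nonneg hle).1 (by rw [hsu]; exact hs00.symm) a (Finset.mem_univ a)
    have hv' : ∀ a, v a - c a = 0 := by
      intro a
      have hle : ∀ a ∈ (Finset.univ : Finset α), 0 ≤ v a - c a := fun a _ => sub_nonneg.2 (hv a)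
      exact (Finset.sum_eq_zero_iff_of_nonneg hle).1 (by rw [hsv]; exact hs00.symm) a (Finset.mem_univ a)
    simp only [hu', hv', zero_mul, Finset.sum_const_zero, sub_self]
    rw [← hs00]
    simp
  · have h1 : s * (∑ a, (u a - c a) * h a - ∑ a, (v a - c a) * h a) ≤ s * (s * D) := by
      rw [hkey]; calc _ ≤ _ := hbound
        _ = s * s * D := hDsum
        _ = s * (s * D) := by ring
    exact le_of_mul_le_mul_left h1 hspos

/-- **Covariance of two functions of small oscillation is small**: for nonnegative weights `ν` of total mass
`Q`, `Q·Σ ν h k − (Σ ν h)(Σ ν k) ≥ −½·Q²·D·E` whenever `h` has oscillation `≤ D` and `k` has oscillation `≤ E`.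
[folklore] -/
theorem cov_ge_neg (ν h k : α → ℝ) (D E : ℝ) (hν : ∀ a, 0 ≤ ν a)
    (hD : ∀ a a', h a - h a' ≤ D) (hE : ∀ a a', k a - k a' ≤ E) :
    -(1 / 2 * (∑ a, ν a) ^ 2 * D * E) ≤
      (∑ a, ν a) * (∑ a, ν a * (h a * k a)) - (∑ a, ν a * h a) * (∑ a, ν a * k a) := by
  -- `2·[Q Σνhk − Σνh Σνk] = Σ_a Σ_a' ν ν' (h a − h a')(k a − k a')`
  have hkey : 2 * ((∑ a, ν a) * (∑ a, ν a * (h a * k a)) - (∑ a, ν a * h a) * (∑ a, ν a * k a)) =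
      ∑ a, ∑ a', ν a * ν a' * ((h a - h a') * (k a - k a')) := by
    have e1 : ∑ a, ∑ a', ν a * ν a' * ((h a - h a') * (k a - k a')) =
        ∑ a, ∑ a', (ν a * (h a * k a) * ν a' + ν a * (ν a' * (h a' * k a')) -
          ν a * h a * (ν a' * k a') - ν a * k a * (ν a' * h a')) :=
      Finset.sum_congr rfl fun a _ => Finset.sum_congr rfl fun a' _ => by ring
    rw [e1]
    simp only [Finset.sum_sub_distrib, Finset.sum_add_distrib, ← Finset.mul_sum, ← Finset.sum_mul]
    ring
  -- each product is `≥ −D·E`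
  have hprod : ∀ a a', -(D * E) ≤ (h a - h a') * (k a - k a') := by
    intro a a'
    have h1 := hD a a'; have h2 := hD a' a; have h3 := hE a a'; have h4 := hE a' a
    rcases le_total 0 (h a - h a') with hh | hh <;> rcases le_total 0 (k a - k a') with hk | hk
    · nlinarith [mul_nonneg hh hk]
    · nlinarith [mul_le_mul_of_nonneg_left h4 hh, h1]
    · nlinarith [mul_le_mul_of_nonneg_left h2 hk, h3]
    · nlinarith [mul_nonneg_of_nonpos_of_nonpos hh hk]
  have hsum : ∑ a, ∑ a', ν a * ν a' * (-(D * E)) ≤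
      ∑ a, ∑ a', ν a * ν a' * ((h a - h a') * (k a - k a')) :=
    Finset.sum_le_sum fun a _ => Finset.sum_le_sum fun a' _ =>
      mul_le_mul_of_nonneg_left (hprod a a') (mul_nonneg (hν a) (hν a'))
  have hconst : ∑ a, ∑ a', ν a * ν a' * (-(D * E)) = -((∑ a, ν a) ^ 2 * D * E) := by
    simp only [← Finset.sum_mul, ← Finset.mul_sum]
    ring
  rw [hconst] at hsum
  linarith [hkey]

/-- **Transfer of a pair sum to the conditional averages.**  With `m₀ b = Σ_a p a κ a b` and `TX b · m₀ b = Σ_a p a κ a b X a`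
(so `TX b` is the average of `X` over the copy-0 configurations compatible with `b`),
`Σ_a Σ_b p a p' b κ a b X a = Σ_a Σ_b p a p' b κ a b · TX b`. [folklore] -/
theorem pair_sum_transfer (p : α → ℝ) (p' : β → ℝ) (κ : α → β → ℝ) (X : α → ℝ)
    (m₀ TX : β → ℝ) (hm₀ : ∀ b, m₀ b = ∑ a, p a * κ a b)
    (hTX : ∀ b, TX b * m₀ b = ∑ a, p a * κ a b * X a) :
    ∑ a, ∑ b, p a * p' b * κ a b * X a = ∑ a, ∑ b, p a * p' b * κ a b * TX b := by
  rw [Finset.sum_comm]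
  conv_rhs => rw [Finset.sum_comm]
  refine Finset.sum_congr rfl fun b _ => ?_
  have e1 : ∑ a, p a * p' b * κ a b * X a = p' b * (∑ a, p a * κ a b * X a) := by
    rw [Finset.mul_sum]; exact Finset.sum_congr rfl fun a _ => by ring
  have e2 : ∑ a, p a * p' b * κ a b * TX b = p' b * (TX b * m₀ b) := by
    rw [hm₀ b, Finset.mul_sum, Finset.mul_sum]; exact Finset.sum_congr rfl fun a _ => by ring
  rw [e1, e2, hTX b]

/-- Positive association for two ANTITONE functions follows from positive association for monotone pairs
(apply it to `−h, −k`). [folklore] -/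
theorem pa_anti_anti [Preorder α] (q h k : α → ℝ)
    (hPA : ∀ F G : α → ℝ, Monotone F → Monotone G →
      (∑ a, q a * F a) * (∑ a, q a * G a) ≤ (∑ a, q a) * (∑ a, q a * (F a * G a)))
    (hh : Antitone h) (hk : Antitone k) :
    (∑ a, q a * h a) * (∑ a, q a * k a) ≤ (∑ a, q a) * (∑ a, q a * (h a * k a)) := by
  have := hPA (fun a => -h a) (fun a => -k a) hh.neg hk.neg
  simpa only [mul_neg, Finset.sum_neg_distrib, neg_mul, neg_neg] using this

/-- Positive association gives NEGATIVE correlation of a monotone and an antitone function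
(apply it to `F, −k`). [folklore] -/
theorem pa_mono_anti [Preorder α] (q F k : α → ℝ)
    (hPA : ∀ F G : α → ℝ, Monotone F → Monotone G →
      (∑ a, q a * F a) * (∑ a, q a * G a) ≤ (∑ a, q a) * (∑ a, q a * (F a * G a)))
    (hF : Monotone F) (hk : Antitone k) :
    (∑ a, q a) * (∑ a, q a * (F a * k a)) ≤ (∑ a, q a * F a) * (∑ a, q a * k a) := by
  have := hPA F (fun a => -k a) hF hk.neg
  simp only [mul_neg, Finset.sum_neg_distrib] at this
  linarith

section TwoCopies

variable [Preorder α] [Preorder β]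

omit [Preorder α] [Preorder β] in
/-- **Transfer**: `Σ_a ν₀ a X a = Σ_b ν₁ b (TX) b`, where `ν₀ a = Σ_b p a p' b κ a b`, `ν₁ b = Σ_a p a p' b κ a b`
are the two marginals of the pair weight and `TX` is the conditional average of `X` given the partner `b`
(`TX b · m₀ b = Σ_a p a κ a b X a`, `m₀ b = Σ_a p a κ a b`). [folklore] -/
theorem transfer (p : α → ℝ) (p' : β → ℝ) (κ : α → β → ℝ) (X ν₀ : α → ℝ) (ν₁ m₀ TX : β → ℝ)
    (hν₀ : ∀ a, ν₀ a = ∑ b, p a * p' b * κ a b) (hν₁ : ∀ b, ν₁ b = ∑ a, p a * p' b * κ a b)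
    (hm₀ : ∀ b, m₀ b = ∑ a, p a * κ a b) (hTX : ∀ b, TX b * m₀ b = ∑ a, p a * κ a b * X a) :
    ∑ a, ν₀ a * X a = ∑ b, ν₁ b * TX b := by
  have e1 : ∑ a, ν₀ a * X a = ∑ a, ∑ b, p a * p' b * κ a b * X a :=
    Finset.sum_congr rfl fun a _ => by rw [hν₀ a, Finset.sum_mul]
  have e2 : ∑ b, ν₁ b * TX b = ∑ a, ∑ b, p a * p' b * κ a b * TX b := by
    rw [Finset.sum_comm]
    exact Finset.sum_congr rfl fun b _ => by rw [hν₁ b, Finset.sum_mul]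
  rw [e1, e2]
  exact pair_sum_transfer p p' κ X m₀ TX hm₀ hTX

omit [Preorder α] [Preorder β] in
/-- **The averaging step.**  With the notation of `transfer`, if copy 0 is conditionally positively associated
given each partner `b` (`hPAb`, the instance of the "downward FKG" hypothesis for the pair `F, G`), then the
covariance form of `(F, G)` under `ν₀` dominates the covariance form of the conditional averages `(TF, TG)` under `ν₁`:
`Q·Σν₁ TF·TG − (Σν₁TF)(Σν₁TG) ≤ Q·Σν₀ F·G − (Σν₀F)(Σν₀G)`  (the difference is `Q·Σ_b ν₁ b [T(FG) − TF·TG](b) ≥ 0`).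
[this work; the step is the measure-level argument of prim-nh-lead-4575 LEAD-GEN105 §1(6)] -/
theorem step (p : α → ℝ) (p' : β → ℝ) (κ : α → β → ℝ) (F G ν₀ : α → ℝ) (ν₁ m₀ TF TG TFG : β → ℝ) (Q : ℝ)
    (hQ : 0 ≤ Q) (hν₁0 : ∀ b, 0 ≤ ν₁ b)
    (hν₀ : ∀ a, ν₀ a = ∑ b, p a * p' b * κ a b) (hν₁ : ∀ b, ν₁ b = ∑ a, p a * p' b * κ a b)
    (hm₀ : ∀ b, m₀ b = ∑ a, p a * κ a b) (hm₀pos : ∀ b, 0 < m₀ b)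
    (hTF : ∀ b, TF b * m₀ b = ∑ a, p a * κ a b * F a)
    (hTG : ∀ b, TG b * m₀ b = ∑ a, p a * κ a b * G a)
    (hTFG : ∀ b, TFG b * m₀ b = ∑ a, p a * κ a b * (F a * G a))
    (hPAb : ∀ b, (∑ a, p a * κ a b * F a) * (∑ a, p a * κ a b * G a) ≤
      (∑ a, p a * κ a b) * (∑ a, p a * κ a b * (F a * G a))) :
    Q * (∑ b, ν₁ b * (TF b * TG b)) - (∑ b, ν₁ b * TF b) * (∑ b, ν₁ b * TG b) ≤
      Q * (∑ a, ν₀ a * (F a * G a)) - (∑ a, ν₀ a * F a) * (∑ a, ν₀ a * G a) := by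
  rw [transfer p p' κ F ν₀ ν₁ m₀ TF hν₀ hν₁ hm₀ hTF, transfer p p' κ G ν₀ ν₁ m₀ TG hν₀ hν₁ hm₀ hTG,
    transfer p p' κ (fun a => F a * G a) ν₀ ν₁ m₀ TFG hν₀ hν₁ hm₀ hTFG]
  -- pointwise `TF b · TG b ≤ TFG b`
  have hpt : ∀ b, TF b * TG b ≤ TFG b := by
    intro b
    have h := hPAb b
    rw [← hTF b, ← hTG b, ← hm₀ b, ← hTFG b] at h
    have hm := hm₀pos b
    have h' : m₀ b * m₀ b * (TF b * TG b) ≤ m₀ b * m₀ b * TFG b := by nlinarith [h]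
    exact le_of_mul_le_mul_left h' (mul_pos hm hm)
  have hsum : ∑ b, ν₁ b * (TF b * TG b) ≤ ∑ b, ν₁ b * TFG b :=
    Finset.sum_le_sum fun b _ => mul_le_mul_of_nonneg_left (hpt b) (hν₁0 b)
  nlinarith [mul_le_mul_of_nonneg_left hsum hQ]

omit [Fintype β] in
/-- **Averaging flips monotonicity**: for a `0/1` compatibility kernel `κ` that is antitone in each argument and a
copy 0 that is conditionally positively associated given each partner, the conditional average `TF` of a MONOTONE
`F` is ANTITONE in the partner.  [this work; cf. van den Berg–Häggström–Kahn 2006, proof of Thm. 1.5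
("the conditional distribution … is stochastically decreasing in `W`")] -/
theorem transfer_antitone (p : α → ℝ) (κ : α → β → ℝ) (F : α → ℝ) (m₀ TF : β → ℝ)
    (hκ01 : ∀ a b, κ a b = 0 ∨ κ a b = 1)
    (hκa : ∀ b, Antitone (fun a => κ a b)) (hκb : ∀ a, Antitone (κ a))
    (hm₀ : ∀ b, m₀ b = ∑ a, p a * κ a b) (hm₀pos : ∀ b, 0 < m₀ b)
    (hTF : ∀ b, TF b * m₀ b = ∑ a, p a * κ a b * F a)
    (hPA : ∀ b (F G : α → ℝ), Monotone F → Monotone G →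
      (∑ a, p a * κ a b * F a) * (∑ a, p a * κ a b * G a) ≤
        (∑ a, p a * κ a b) * (∑ a, p a * κ a b * (F a * G a)))
    (hF : Monotone F) : Antitone TF := by
  intro b b' hbb'
  -- `κ a b · κ a b' = κ a b'`
  have hkk : ∀ a, κ a b * κ a b' = κ a b' := by
    intro a
    rcases hκ01 a b' with h0 | h1
    · rw [h0, mul_zero]
    · have hle : κ a b' ≤ κ a b := hκb a hbb'
      rcases hκ01 a b with h0' | h1'
      · exfalso; rw [h1, h0'] at hle; norm_num at hle
      · rw [h1, h1', mul_one]
  have h := pa_mono_anti (fun a => p a * κ a b) F (fun a => κ a b') (hPA b) hF (hκa b')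
  have e1 : ∑ a, p a * κ a b * (F a * κ a b') = TF b' * m₀ b' := by
    rw [hTF b']
    exact Finset.sum_congr rfl fun a _ => by
      rw [show p a * κ a b * (F a * κ a b') = p a * F a * (κ a b * κ a b') by ring, hkk a]; ring
  have e2 : ∑ a, p a * κ a b * κ a b' = m₀ b' := by
    rw [hm₀ b']; exact Finset.sum_congr rfl fun a _ => by rw [mul_assoc, hkk a]
  rw [e1, e2, ← hm₀ b, ← hTF b] at h
  -- `m₀ b · (TF b' · m₀ b') ≤ TF b · m₀ b · m₀ b'`
  have hm := hm₀pos b; have hm' := hm₀pos b'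
  have h' : m₀ b * m₀ b' * TF b' ≤ m₀ b * m₀ b' * TF b := by nlinarith [h]
  exact le_of_mul_le_mul_left h' (mul_pos hm hm')

omit [Fintype β] in
/-- The antitone input version of `transfer_antitone`: the conditional average of an ANTITONE function is MONOTONE.
[this work] -/
theorem transfer_monotone (p : α → ℝ) (κ : α → β → ℝ) (F : α → ℝ) (m₀ TF : β → ℝ)
    (hκ01 : ∀ a b, κ a b = 0 ∨ κ a b = 1)
    (hκa : ∀ b, Antitone (fun a => κ a b)) (hκb : ∀ a, Antitone (κ a))
    (hm₀ : ∀ b, m₀ b = ∑ a, p a * κ a b) (hm₀pos : ∀ b, 0 < m₀ b)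
    (hTF : ∀ b, TF b * m₀ b = ∑ a, p a * κ a b * F a)
    (hPA : ∀ b (F G : α → ℝ), Monotone F → Monotone G →
      (∑ a, p a * κ a b * F a) * (∑ a, p a * κ a b * G a) ≤
        (∑ a, p a * κ a b) * (∑ a, p a * κ a b * (F a * G a)))
    (hF : Antitone F) : Monotone TF := by
  have h := transfer_antitone p κ (fun a => -F a) m₀ (fun b => -TF b) hκ01 hκa hκb hm₀ hm₀pos
    (fun b => by
      rw [neg_mul, hTF b, ← Finset.sum_neg_distrib]
      exact Finset.sum_congr rfl fun a _ => by ring) hPA hF.neg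
  intro b b' hbb'
  have := h hbb'
  simp only [neg_le_neg_iff] at this
  exact this

omit [Fintype β] [Preorder α] [Preorder β] in
/-- **Contraction of the averaging operator** (Doeblin): if every configuration of the bottom set `B₀` is compatible
with every partner (`κ a b = 1` for `a ∈ B₀`), then the conditional averages contract oscillations by the factor
`1 − p(B₀)/p(α)`. [folklore] -/
theorem transfer_contract (p : α → ℝ) (κ : α → β → ℝ) (h : α → ℝ) (m₀ Th : β → ℝ) (B₀ : Finset α) (D : ℝ)
    (hp : ∀ a, 0 ≤ p a) (hκ0 : ∀ a b, 0 ≤ κ a b) (hκ1 : ∀ a b, κ a b ≤ 1)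
    (hB₀ : ∀ a ∈ B₀, ∀ b, κ a b = 1) (hB₀pos : 0 < ∑ a ∈ B₀, p a)
    (hm₀ : ∀ b, m₀ b = ∑ a, p a * κ a b) (hm₀pos : ∀ b, 0 < m₀ b)
    (hTh : ∀ b, Th b * m₀ b = ∑ a, p a * κ a b * h a)
    (hD : ∀ a a', h a - h a' ≤ D) :
    ∀ b b', Th b - Th b' ≤ (1 - (∑ a ∈ B₀, p a) / (∑ a, p a)) * D := by
  classical
  intro b b'
  have hM : 0 < ∑ a, p a := lt_of_lt_of_le hB₀pos
    (Finset.sum_le_sum_of_subset_of_nonneg (Finset.subset_univ B₀) fun a _ _ => hp a)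
  have hmM : ∀ b, m₀ b ≤ ∑ a, p a := fun b => by
    rw [hm₀ b]; exact Finset.sum_le_sum fun a _ => by nlinarith [hp a, hκ1 a b]
  -- kernel rows and the common minorant
  set c : α → ℝ := fun a => (if a ∈ B₀ then p a else 0) / ∑ a, p a with hc
  have hcsum : ∑ a, c a = (∑ a ∈ B₀, p a) / ∑ a, p a := by
    rw [hc]; simp only
    rw [← Finset.sum_div, Finset.sum_ite_mem, Finset.univ_inter]
  have hrow : ∀ b, ∑ a, p a * κ a b / m₀ b = 1 := fun b => by
    rw [← Finset.sum_div, ← hm₀ b]; exact div_self (ne_of_gt (hm₀pos b))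
  have hrowh : ∀ b, ∑ a, p a * κ a b / m₀ b * h a = Th b := fun b => by
    have e : ∑ a, p a * κ a b / m₀ b * h a = (∑ a, p a * κ a b * h a) / m₀ b := by
      rw [Finset.sum_div]; exact Finset.sum_congr rfl fun a _ => by ring
    rw [e, ← hTh b, mul_div_cancel_right₀ _ (ne_of_gt (hm₀pos b))]
  have hdom : ∀ b a, c a ≤ p a * κ a b / m₀ b := by
    intro b a
    rw [hc]; simp only
    split_ifs with ha
    · rw [hB₀ a ha b, mul_one]
      exact div_le_div_of_nonneg_left (hp a) (hm₀pos b) (hmM b)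
    · rw [zero_div]; exact div_nonneg (mul_nonneg (hp a) (hκ0 a b)) (hm₀pos b).le
  have key := markov_contract (fun a => p a * κ a b / m₀ b) (fun a => p a * κ a b' / m₀ b') c h D
    (hdom b) (hdom b') (hrow b) (hrow b') hD
  rw [hrowh b, hrowh b', hcsum] at key
  exact key

end TwoCopies

end TwoCopyHardCore

end Summit.CriticalPhenomena.PercolationContinuityZ3.Theorems
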